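import Mathlib
import HarnessLib
import Literature.Analysis.FluidPDE.SelfSimilar
import Literature.Analysis.FluidPDE.TypeIAncientMildRescale
import Summits.NavierStokesRegularity.NavierStokesRegularity.Theorems.PoloidalWindowDoorLrcModEntireQ4CurvedFlatLimitEntrance
import Summits.NavierStokesRegularity.NavierStokesRegularity.Theorems.PoloidalWindowDoorLrcModEntireQ4CurvedSlopeWindow
import Summits.NavierStokesRegularity.NavierStokesRegularity.Theorems.PoloidalWindowDoorLrcModEntireQ4CurvedFlatCurtainWindow
import Summits.NavierStokesRegularity.NavierStokesRegularity.Theorems.SqueezeCycleExtremalElementExistsExtraction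
import Summits.NavierStokesRegularity.NavierStokesRegularity.Theorems.PoloidalWindowDoorPoloidalWindowRigidityEternalCoreScalingCore
import Summits.NavierStokesRegularity.NavierStokesRegularity.Theorems.PoloidalWindowDoorPoloidalWindowRigidityPoloidalExtremal

/-!
# Route `PoloidalWindowDoor`, item `LrcModEntire` (stmt-NavierStokesRegularity-20428), line twist_split — v17 CLOSER CORE:
# A FLAT SCALING LIMIT KILLS THE VERTICAL CHILD (`false_of_flatScalingLimit`)

LEAD-lineage ns-poloidal-K2-p3 g18 (`--supports stmt-NavierStokesRegularity-20428 --as helper`).  Statement = the skeleton of ns-poloidal-K2-p2 g18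
(HOME ns-poloidal-K2-p2/g18/FlatLimit-skeleton.lean 77dd51f178ae0c90, refuter1 g26 currency check 03:13:22Z): the class data of the hull element `U` in
binder currency, poloidal, the hot value `U₂(−1,0) ≠ 0`, the GLOBAL (TH) bilinear identity, and the data `(lam, Wl, p, e)` of the v17 literal X_H
(HOME ns-poloidal-K2-p3/g18/v17_literal.txt; the vertical-shear clause of X_H is not needed and is dropped here — the wrapper discards it) ⊢ `False`.  Memo `Cruxes/LrcModEntire/VERT-PROP-g18.md` v4 §10.

Proof (H1–H8 of the LEAD's 02:55Z programme; every endgame is a tree theorem):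
* H1 `IsTypeIAncientMild C U` (`…PoloidalWindowRigidityWindow.isTypeIAncientMild_of_class`);
* H2 the ETERNAL CORE of `U` at the origin from the hot value (`…Q4CurvedFlatLimitEntrance.eternalCore_of_hotValue_class`, ns-k2-port-2 g9 — the
  contrapositive of the PARABOLOID GAP `…EternalCoreParaboloidGap.paraboloidGap`, LINE 23);
* H3 class compactness WITH derivative convergence (`…SqueezeCycleExtremalElementExistsExtraction.exists_tendsto_of_isTypeIAncientMild_seq`) applied to the
  rescalings `nsRescale (lam n) U` (`IsTypeIAncientMild.nsRescale`) ⇒ a subsequence `φ` and a CLASS limit `W′`; `W′ t = Wl t` for `t < 0` by uniqueness of limits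
  (`…Entrance.eq_of_tendstoLocallyUniformly_subseq`) — so (O1/O2 of idea-crit-7 g12) every curtain clause and all differentiability are routed through `W′`, never
  through `Wl`;
* H4 the core is scale-covariant (`…EternalCoreScalingCore.eternalCore_nsRescale`, `lam ≥ 1` keeps the windows below `−1`) and passes to the limit
  (`eternalCore_of_limit`) ⇒ `W′ ≢ 0`;
* H5 `W′` poloidal (`…PoloidalExtremal.poloidal_nsRescale` + `poloidal_of_tendsto`) and (TH)-bilinear (`…Entrance.bilinearTH_nsRescale` + `bilinearTH_of_tendsto_fderiv`);
* H6 the flat curtain of `Wl (−1) = W′ (−1)`;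
* H7–H8 `false_of_flatCurtain_anywhere` (below): a class profile with a flat vertical critical curtain at `t = −1` ANYWHERE is trivial — H7a
  `…Q4CurvedSlopeWindow.slopeWindow_of_nonzero` (LEAD g18: a non-trivial profile has a height window of proportional-shear planes with non-zero slope; the
  all-flat / zero-shear corners die by `…TimeHeightShearNormalForm.eq_zero_of_flatPlanes_open` / `…VerticalShearGerm`) + H7b
  `…Q4CurvedFlatCurtainWindow.false_of_flatCurtain_slopeWindow` (ns-poloidal-K2-p2 g19: translate, Cauchy–Kovalevskaya across the non-characteristic plane
  `…FlatCurtain.fderiv_apply_eq_zero_of_flatCurtain` (K2-p2 g18), `…HorizontalGerm.eq_zero_of_horizontalDeriv_two_eq_zero`) — contradiction with H4.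

WHAT THIS IS NOT: not a claim about Navier–Stokes regularity; it closes the CLOSABLE child of the v17 split only (registry wrapper
`…Q4CurvedAperiodicVerticalFlatLimitStub`); the research child «no scaling limit has a flat curtain» stays OPEN; items 20428 / 19708 / 27893 OPEN (bears_on LADDER-NS N0).
-/

noncomputable section

set_option linter.dupNamespace false
set_option linter.style.longLine false

namespace Summit.NavierStokesRegularity.NavierStokesRegularity.Theorems.PoloidalWindowDoorLrcModEntireQ4CurvedFlatLimit

open Set Function Filter Topology Metric
open scoped RealInnerProductSpace InnerProductSpace ContDiff
open Literature.Analysis Literature.Analysis.FluidPDE Literature.Analysis.UnboundedOperators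
open Summit.NavierStokesRegularity.NavierStokesRegularity.Theorems
open Summit.NavierStokesRegularity.NavierStokesRegularity.Theorems.PoloidalWindowDoorPoloidalWindowRigidityWindow
open Summit.NavierStokesRegularity.NavierStokesRegularity.Theorems.PoloidalWindowDoorLrcModEntireQ4CurvedFlatLimitEntrance
open Summit.NavierStokesRegularity.NavierStokesRegularity.Theorems.PoloidalWindowDoorLrcModEntireQ4CurvedSlopeWindow
open Summit.NavierStokesRegularity.NavierStokesRegularity.Theorems.PoloidalWindowDoorLrcModEntireQ4CurvedFlatCurtainWindow
open Summit.NavierStokesRegularity.NavierStokesRegularity.Theorems.PoloidalWindowDoorPoloidalWindowRigidityEternalCoreScalingCore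
open Summit.NavierStokesRegularity.NavierStokesRegularity.Theorems.PoloidalWindowDoorPoloidalWindowRigidityPoloidalExtremal

/-- **H7: a class profile with a flat vertical critical curtain at `t = −1` anywhere is trivial** — H7a (`slopeWindow_of_nonzero`) + H7b
(`false_of_flatCurtain_slopeWindow`). -/
theorem false_of_flatCurtain_anywhere {C : ℝ} {W : ℝ → EuclideanSpace ℝ (Fin 3) → EuclideanSpace ℝ (Fin 3)}
    (hrate : HasTypeITimeDecay C W) (hcont : ContinuousOn (uncurry W) (Iio (0 : ℝ) ×ˢ univ))
    (hmild : ∀ s t : ℝ, s < t → t < 0 → ∀ x, W t x = heatExtension (W s) (t - s) x - oseenDuhamel 1 s W W t x)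
    (hdiv : ∀ t < 0, VectorCalculus.IsDivFree (W t))
    (hpol : ∀ s < 0, ∀ q, ⟪curl (W s) q, EuclideanSpace.single 2 1⟫_ℝ = 0)
    (hbil : ∀ t < 0, ∀ x x' : EuclideanSpace ℝ (Fin 3), x 2 = x' 2 → ∀ b c : Fin 3, b ≠ 2 → c ≠ 2 →
      fderiv ℝ (W t) x (EuclideanSpace.single 2 1) b * fderiv ℝ (W t) x' (EuclideanSpace.single c 1) 2 =
        fderiv ℝ (W t) x' (EuclideanSpace.single 2 1) c * fderiv ℝ (W t) x (EuclideanSpace.single b 1) 2)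
    {p e : EuclideanSpace ℝ (Fin 3)} (he2 : e 2 = 0) (he : e ≠ 0)
    (hcurt : ∀ s z : ℝ, ∀ w : EuclideanSpace ℝ (Fin 3), w 2 = 0 →
      fderiv ℝ (fun y => W (-1) y 2) (p + s • e + z • EuclideanSpace.single 2 (1 : ℝ)) w = 0)
    (hne : ∃ t < 0, ∃ x, W t x ≠ 0) : False := by
  obtain ⟨c₀, η, hη, μ, hμ, hslope⟩ := slopeWindow_of_nonzero hrate hcont hmild hdiv hpol hbil hne
  exact false_of_flatCurtain_slopeWindow hrate hcont hmild hdiv hpol hη hμ hslope he2 he hcurt hne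

/-- ★ **A FLAT SCALING LIMIT KILLS THE VERTICAL CHILD.**  See the module docstring (H1–H8). -/
theorem false_of_flatScalingLimit {C : ℝ} {U : ℝ → EuclideanSpace ℝ (Fin 3) → EuclideanSpace ℝ (Fin 3)}
    (hrate : HasTypeITimeDecay C U) (hcont : ContinuousOn (uncurry U) (Iio (0 : ℝ) ×ˢ univ))
    (hmild : ∀ s t : ℝ, s < t → t < 0 → ∀ x, U t x = heatExtension (U s) (t - s) x - oseenDuhamel 1 s U U t x)
    (hdiv : ∀ t < 0, VectorCalculus.IsDivFree (U t))
    (hpol : ∀ s < 0, ∀ q, ⟪curl (U s) q, EuclideanSpace.single 2 1⟫_ℝ = 0)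
    (hne : U (-1) 0 2 ≠ 0)
    (hbil : ∀ t < 0, ∀ x x' : EuclideanSpace ℝ (Fin 3), x 2 = x' 2 → ∀ b c : Fin 3, b ≠ 2 → c ≠ 2 →
      fderiv ℝ (U t) x (EuclideanSpace.single 2 1) b * fderiv ℝ (U t) x' (EuclideanSpace.single c 1) 2 =
        fderiv ℝ (U t) x' (EuclideanSpace.single 2 1) c * fderiv ℝ (U t) x (EuclideanSpace.single b 1) 2)
    {lam : ℕ → ℝ} {Wl : ℝ → EuclideanSpace ℝ (Fin 3) → EuclideanSpace ℝ (Fin 3)} {p e : EuclideanSpace ℝ (Fin 3)}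
    (hlam : ∀ n : ℕ, 1 ≤ lam n)
    (hWl : ∀ t < 0, TendstoLocallyUniformly (fun n : ℕ => Literature.Analysis.FluidPDE.nsRescale (lam n) U t) (Wl t) atTop)
    (he2 : e 2 = 0) (he : e ≠ 0)
    (hcurt : ∀ s z : ℝ, ∀ w : EuclideanSpace ℝ (Fin 3), w 2 = 0 →
      fderiv ℝ (fun y => Wl (-1) y 2) (p + s • e + z • EuclideanSpace.single 2 (1 : ℝ)) w = 0) :
    False := by
  -- H1: the hull element is in the Type-I ancient mild class
  have hA : IsTypeIAncientMild C U := isTypeIAncientMild_of_class hrate hcont hmild hdiv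
  -- H2: the eternal core of `U` at the origin (paraboloid gap + hot value)
  obtain ⟨ε₀, R₀, hε₀, hR₀, hcoreU⟩ := eternalCore_of_hotValue_class hrate hcont hmild hdiv hne
  -- the rescaled sequence stays in the class
  have hlam0 : ∀ n, 0 < lam n := fun n => lt_of_lt_of_le one_pos (hlam n)
  set w : ℕ → ℝ → EuclideanSpace ℝ (Fin 3) → EuclideanSpace ℝ (Fin 3) :=
    fun n => Literature.Analysis.FluidPDE.nsRescale (lam n) U with hw_def
  have hw : ∀ n, IsTypeIAncientMild C (w n) := fun n => hA.nsRescale (hlam0 n)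
  -- H3: class compactness with derivative convergence
  obtain ⟨φ, hφ, W', hW', hpt, hfd, -, -⟩ := exists_tendsto_of_isTypeIAncientMild_seq C hw
  -- identification of the class limit with `Wl` on the open slab
  have hWW : ∀ t < 0, ∀ x, W' t x = Wl t x := fun t ht x =>
    eq_of_tendstoLocallyUniformly_subseq (hWl t ht) hφ (hpt t ht x)
  have hW1 : W' (-1) = Wl (-1) := funext (hWW (-1) (by norm_num))
  -- H4: the core passes to `W′`, so `W′ ≢ 0`
  have hcoreW : ∀ t₀ : ℝ, t₀ < (-1) → ∃ r ∈ Set.Icc (4 * t₀) t₀, ∃ y : EuclideanSpace ℝ (Fin 3),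
      ‖y‖ ≤ R₀ * Real.sqrt (-r) ∧ ε₀ ≤ Real.sqrt (-r) * ‖W' r y‖ := by
    refine eternalCore_of_limit C ε₀ R₀ (-1) (by norm_num) (fun j => hw (φ j)) hW' hpt fun t₀ ht₀ => ?_
    refine Eventually.of_forall fun j => ?_
    have h1 : (1 : ℝ) ≤ lam (φ j) ^ 2 := by nlinarith [hlam (φ j)]
    have ht : lam (φ j) ^ 2 * t₀ < -1 := by nlinarith
    exact eternalCore_nsRescale hcoreU (hlam0 (φ j)) t₀ ht
  have hneW : ∃ t < 0, ∃ x, W' t x ≠ 0 := by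
    obtain ⟨r, hr, y, -, hε⟩ := hcoreW (-2) (by norm_num)
    refine ⟨r, by linarith [hr.2], y, fun h0 => ?_⟩
    rw [h0, norm_zero, mul_zero] at hε
    exact absurd hε (not_le.2 hε₀)
  -- H5: `W′` is poloidal and carries the (TH) bilinear identity
  have hpolW : ∀ s < 0, ∀ q, ⟪curl (W' s) q, EuclideanSpace.single 2 1⟫_ℝ = 0 := fun s hs q =>
    poloidal_of_tendsto (V := fun j => w (φ j) s) (hfd s hs q) fun j => poloidal_nsRescale hpol (hlam0 (φ j)) s hs q
  have hbilW := bilinearTH_of_tendsto_fderiv (Ws := fun j => w (φ j)) (W := W') hfd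
    fun j => bilinearTH_nsRescale hbil (hlam0 (φ j))
  -- H6: the flat curtain of `Wl (−1) = W′ (−1)`
  have hcurtW : ∀ s z : ℝ, ∀ w : EuclideanSpace ℝ (Fin 3), w 2 = 0 →
      fderiv ℝ (fun y => W' (-1) y 2) (p + s • e + z • EuclideanSpace.single 2 (1 : ℝ)) w = 0 := by
    intro s z w hw0
    rw [hW1]
    exact hcurt s z w hw0
  -- H7–H8: a class profile with a flat vertical critical curtain anywhere is trivial
  exact false_of_flatCurtain_anywhere hW'.hasTypeITimeDecay hW'.continuousOn_uncurry
    (fun s t hst ht x => hW'.mild_eq_heatExtension hst ht x) (fun t ht => hW'.isDivFree ht) hpolW hbilW he2 he hcurtW hneW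

end Summit.NavierStokesRegularity.NavierStokesRegularity.Theorems.PoloidalWindowDoorLrcModEntireQ4CurvedFlatLimit

end
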